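import Mathlib

/-!
# OsculationR25 — kernel companion of memo `R25-OSCULATION-AND-CONVEXITY.md`
(toric-towers ROUND 25 · res-L1-w45b-idea-1 g34 · crux `EquisingularLiftNatThree` = stmt-ResolutionOfSingularities-20148)

OURS · counted 0 · EL♮(3) NOT proved · AI-written, weaker than expert review · nothing attributed to Hironaka.
This file types the BOOKKEEPING of R25 (layer identities, support inequalities, trace factorisations,
constants); the geometric statements (Theorem 3, Corollary 4) live in the memo.  Nothing here is a
route item; nothing imports the route file.

* Part A — layers: the two lowest layers of `e·S² + (deg ≥ 12)` are `e·S₄²` and `2e·S₄·S₆`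
  (Prop. 1), the divisibility step of Cor. 2(a), the Gauss step of Cor. 2(b), the evaluation
  kernel of the SLOPE LAW (C3).
* Part B — support inequalities over ℤ (transport lemma, fibre-round layer minima, preservation
  of the convexity invariant (C4) under `pt` and `fib`, the contents `m_pt`, `m_fib`).
* Part C — traces and constants (exit factorisations for c = 2, 3; the cubic member `2κ`;
  the frozen relation; the sign law of `h`).
-/

set_option linter.dupNamespace false

namespace Summit.ResolutionOfSingularities.ResolutionOfSingularities.Cruxes.EquisingularLiftNatThree.ToricTowers.R25

section Layers

variable {R : Type*} [CommRing R]

/-- Prop. 1: the formal-weight expansion of `(S₄w⁴ + S₆w⁶ + w⁸U)²`; the `w⁸`- and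
`w¹⁰`-coefficients are `S₄²` and `2S₄S₆`, everything else has weight ≥ 12. -/
theorem layer_expansion (S4 S6 U w : R) :
    (S4 * w ^ 4 + S6 * w ^ 6 + w ^ 8 * U) ^ 2
      = S4 ^ 2 * w ^ 8 + (2 * S4 * S6) * w ^ 10
        + w ^ 12 * (S6 ^ 2 + 2 * S4 * U + 2 * S6 * U * w ^ 2 + U ^ 2 * w ^ 4) := by
  ring

/-- Prop. 1 with the unit `e = v^ε` and the tail `w¹²·G` (`G₀∘π ∈ F₁₂`). -/
theorem T_expansion (e S4 S6 U G w : R) :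
    e * (S4 * w ^ 4 + S6 * w ^ 6 + w ^ 8 * U) ^ 2 + w ^ 12 * G
      = (e * S4 ^ 2) * w ^ 8 + (2 * e * S4 * S6) * w ^ 10
        + w ^ 12 * (e * (S6 ^ 2 + 2 * S4 * U + 2 * S6 * U * w ^ 2 + U ^ 2 * w ^ 4) + G) := by
  ring

/-- Cor. 2(a): a factor of the 4-layer of `S` divides the 10-layer of `T`. -/
theorem dvd_of_layer10 (L S4 S6 e T10 : R) (hL : L ∣ S4) (hT : T10 = 2 * e * S4 * S6) :
    L ∣ T10 := by
  subst hT
  exact (hL.mul_left (2 * e)).mul_right S6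

/-- Cor. 2(b), the Gauss step: `v` prime, `v ∣ L·W₀`, `v ∤ L` (L primitive) ⇒ `v ∣ W₀`. -/
theorem gauss_step {v L W : R} (hv : Prime v) (h : v ∣ L * W) (hL : ¬ v ∣ L) : v ∣ W :=
  (hv.dvd_or_dvd h).resolve_left hL

open MvPolynomial in
/-- Kernel of the SLOPE LAW (C3): if the sheet trace `a - t·b` divides the 10-layer trace
`h·b⁹·(a - ψ·b)` with `h ≠ 0`, then `ψ = t` (evaluate at `(a,b) = (t,1)`). -/
theorem slope_law_kernel {K : Type*} [Field K] (h t ψ : K) (hh : h ≠ 0)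
    (W : MvPolynomial (Fin 2) K)
    (hdiv : (X 0 - C t * X 1) * W = C h * X 1 ^ 9 * (X 0 - C ψ * X 1)) : ψ = t := by
  have e := congrArg (MvPolynomial.eval ![t, 1]) hdiv
  simp [hh, sub_eq_zero] at e
  exact e.symm

end Layers

section Support

/-! ### Part B — support inequalities (levels `l`, a-degrees `i`, `s`, (a,b)-degrees `d`, depth `c`) -/

/-- (T-rd): a content-1 round raises the convexity slope by one: `l ≥ c(i-1)`, `i ≥ s ≥ 1`
gives the new level `l + s - 1 ≥ (c+1)(s-1)`. -/
theorem transport_round (c i s l : ℤ) (hc : 0 ≤ c) (_hs : 1 ≤ s) (his : s ≤ i)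
    (hl : c * (i - 1) ≤ l) : (c + 1) * (s - 1) ≤ l + s - 1 := by
  nlinarith

/-- (T-rd) at a root: convexity with slope 1 is created from nothing. -/
theorem transport_round_base (s l : ℤ) (hl : 0 ≤ l) : 1 * (s - 1) ≤ l + s - 1 := by
  linarith

/-- fibre round, 8-layer: the `j + l` value of `a^{2+r} b^{6-r}` at level `c + r(c+1)`. -/
theorem fib_layer8 (c r : ℤ) : (6 - r) + (c + r * (c + 1)) = 6 + c + r * c := by ring

/-- … is strictly above the value `6 + c` of `a²b⁶v^c` as soon as `r ≥ 1`. -/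
theorem fib_layer8_min (c r : ℤ) (hc : 1 ≤ c) (hr : 1 ≤ r) :
    6 + c < (6 - r) + (c + r * (c + 1)) := by
  nlinarith

/-- fibre round, 10-layer: `j + l` for `a^s b^{10-s}` at the convexity level `c(s-1)`. -/
theorem fib_layer10 (c s : ℤ) : (10 - s) + c * (s - 1) = 9 + (c - 1) * (s - 1) := by ring

theorem fib_layer10_ge (c s l : ℤ) (hc : 1 ≤ c) (hs : 1 ≤ s) (hl : c * (s - 1) ≤ l) :
    9 ≤ (10 - s) + l := by
  nlinarith

/-- … with equality at the convexity level iff `c = 1` or `s = 1` (the monomial `ab⁹`). -/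
theorem fib_layer10_eq (c s : ℤ) :
    (10 - s) + c * (s - 1) = 9 ↔ c = 1 ∨ s = 1 := by
  constructor
  · intro h
    have h' : (c - 1) * (s - 1) = 0 := by linear_combination h
    rcases mul_eq_zero.mp h' with h1 | h1
    · left; linarith
    · right; linarith
  · rintro (rfl | rfl) <;> ring

/-- fibre round, layers `d ≥ 12` with `s ≥ 1`: `j + l ≥ 11`. -/
theorem fib_layer12 (c s d l : ℤ) (hc : 1 ≤ c) (hs : 1 ≤ s) (hd : 12 ≤ d)
    (hl : c * (s - 1) ≤ l) : 11 ≤ (d - s) + l := by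
  nlinarith

/-- the point-step content at a C-state of depth `c`. -/
theorem m_pt (c : ℤ) (hc : 1 ≤ c) : min (8 + c) 10 = if c = 1 then 9 else 10 := by
  split_ifs with h
  · subst h; norm_num
  · rw [min_eq_right]; omega

/-- the fibre-round content at a C-state of depth `c`. -/
theorem m_fib (c : ℤ) (hc : 1 ≤ c) : min (6 + c) 9 = if c ≤ 2 then 6 + c else 9 := by
  split_ifs with h
  · rw [min_eq_left]; omega
  · rw [min_eq_right]; omega

/-- `pt` (content 10, `c ≥ 3`) preserves convexity with slope `c - 2`, layers `d ≥ 10`. -/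
theorem pt_preserves_convexity (c i d l : ℤ) (hi : 1 ≤ i) (hd : 10 ≤ d)
    (hl : c * (i - 1) ≤ l) : (c - 2) * (i - 1) ≤ l + d - 10 := by
  nlinarith

/-- … and in the 8-layer for `i ≥ 2`. -/
theorem pt_preserves_convexity8 (c i l : ℤ) (hi : 2 ≤ i) (hl : c * (i - 1) ≤ l) :
    (c - 2) * (i - 1) ≤ l + 8 - 10 := by
  nlinarith

/-- … and for `ab⁷v^l` in the 8-layer (`l ≥ c ≥ 2`). -/
theorem pt_preserves_convexity8_1 (c l : ℤ) (hc : 2 ≤ c) (hl : c ≤ l) :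
    (c - 2) * (1 - 1) ≤ l + 8 - 10 := by
  nlinarith

/-- `fib` (content 9, `c ≥ 4`) preserves convexity with slope `c - 3` whenever `2i + d ≥ 12`
(new level `l + j - 9`, `j = d - i`). -/
theorem fib_preserves_convexity (c i d l : ℤ) (_hi : 1 ≤ i) (h : 12 ≤ 2 * i + d)
    (hl : c * (i - 1) ≤ l) : (c - 3) * (i - 1) ≤ l + (d - i) - 9 := by
  nlinarith

/-- … and for `ab⁷v^l` in the 8-layer (`l ≥ c ≥ 4`). -/
theorem fib_preserves_convexity8_1 (c l : ℤ) (hc : 4 ≤ c) (hl : c ≤ l) :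
    (c - 3) * (1 - 1) ≤ l + (8 - 1) - 9 := by
  nlinarith

/-- the new depth after `pt` (`c ≥ 3`): the 8-layer level `c` goes to `c + 8 - 10 = c - 2`. -/
theorem lambda_pt (c : ℤ) : c + 8 - 10 = c - 2 := by ring

/-- the new depth after `fib` (`c ≥ 4`): `a²b⁶v^c` goes to level `c + 6 - 9 = c - 3`. -/
theorem lambda_fib (c : ℤ) : c + 6 - 9 = c - 3 := by ring

/-- after `fib` with `c ≥ 4` the polar orders drop by one and stay `≥ (c-3) + 1`:
no polar sheet is resurrected. -/
theorem polar_after_fib (c Q : ℤ) (hQ : c + 1 ≤ Q) : (c - 3) + 1 ≤ Q - 1 := by linarith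

end Support

section Traces

/-! ### Part C — traces and constants -/

variable {K : Type*} [Field K]

/-- point exit from depth 2: `C̄²b⁶ℓ² + h b⁹ ℓ = b⁶ ℓ (C̄²ℓ + h b³)`, ℓ = a - ρ b. -/
theorem ptExit_c2 (C h a b ρ : K) :
    C ^ 2 * b ^ 6 * (a - ρ * b) ^ 2 + h * b ^ 9 * (a - ρ * b)
      = b ^ 6 * (a - ρ * b) * (C ^ 2 * (a - ρ * b) + h * b ^ 3) := by
  ring

/-- fibre exit from depth 3: `C̄²a²b⁶ + h a b⁹ = a b⁶ (C̄²a + h b³)`. -/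
theorem fibExit_c3 (C h a b : K) :
    C ^ 2 * a ^ 2 * b ^ 6 + h * a * b ^ 9 = a * b ^ 6 * (C ^ 2 * a + h * b ^ 3) := by
  ring

/-- the cubic member of the degenerate pair is the root of `C̄²ℓ + h b³`. -/
theorem cubic_member_root (C h b : K) (hC : C ≠ 0) :
    C ^ 2 * (-(h / C ^ 2) * b ^ 3) + h * b ^ 3 = 0 := by
  field_simp
  ring

/-- in characteristic `≠ 2` the constants `8 = 2³`, `64 = 2⁶` are units. -/
theorem eight_ne_zero (h2 : (2 : K) ≠ 0) : (8 : K) ≠ 0 := by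
  rw [show (8 : K) = 2 ^ 3 by norm_num]; exact pow_ne_zero _ h2

theorem sixtyfour_ne_zero (h2 : (2 : K) ≠ 0) : (64 : K) ≠ 0 := by
  rw [show (64 : K) = 2 ^ 6 by norm_num]; exact pow_ne_zero _ h2

/-- with `h = -16μc'` and `C̄ = 8c'`: `-(h/C̄²) = 2κ`, `κ = μ/(8c')` (lead-1 14.6(b), idea-3 l.85798 (2));
characteristic `≠ 2`. -/
theorem cubic_member (μ c' : K) (hc : c' ≠ 0) (h2 : (2 : K) ≠ 0) :
    -((-16 * μ * c') / (8 * c') ^ 2) = 2 * (μ / (8 * c')) := by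
  have h8 := eight_ne_zero (K := K) h2
  have h64 := sixtyfour_ne_zero (K := K) h2
  field_simp
  ring

/-- the frozen relation `64 c'² κ² = μ² (= -λ₀)`; characteristic `≠ 2`. -/
theorem frozen_relation (μ c' κ : K) (hc : c' ≠ 0) (h2 : (2 : K) ≠ 0) (hκ : κ = μ / (8 * c')) :
    64 * c' ^ 2 * κ ^ 2 = μ ^ 2 := by
  have h8 := eight_ne_zero (K := K) h2
  have h64 := sixtyfour_ne_zero (K := K) h2
  subst hκ
  field_simp
  ring

/-- `∂_a(Φ₊Φ₋)` on `Φ₊ = 0`: `Φ₋ · ∂_aΦ₊` with `Φ₋ = Φ₊ - 2μb⁶`, `∂_aΦ₊ = 8c'b³`. -/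
theorem dA_on_exit_plus (μ c' b : K) :
    (0 - 2 * μ * b ^ 6) * (8 * c' * b ^ 3) = -16 * μ * c' * b ^ 9 := by ring

theorem dA_on_exit_minus (μ c' b : K) :
    (0 + 2 * μ * b ^ 6) * (8 * c' * b ^ 3) = 16 * μ * c' * b ^ 9 := by ring

/-- sign law at a D11 root, `f = b⁶(C̄²ℓ² + h b³ℓ)`, `∂_a f = b⁶(2C̄²ℓ + h b³)`:
`+h b⁹` on the line `ℓ = 0` … -/
theorem sign_law_line (C h b : K) : b ^ 6 * (2 * C ^ 2 * 0 + h * b ^ 3) = h * b ^ 9 := by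
  ring

/-- … and `-h b⁹` on the cubic `ℓ = -(h/C̄²)b³`. -/
theorem sign_law_cubic (C h b : K) (hC : C ≠ 0) :
    b ^ 6 * (2 * C ^ 2 * (-(h / C ^ 2) * b ^ 3) + h * b ^ 3) = -(h * b ^ 9) := by
  field_simp
  ring

/-- the polynomial identity behind `∂_a f` at a D11 root:
`f(ℓ+δ) - f(ℓ) = δ·b⁶(2C̄²ℓ + h b³) + C̄²b⁶δ²`. -/
theorem D11_difference (C h b ℓ δ : K) :
    b ^ 6 * (C ^ 2 * (ℓ + δ) ^ 2 + h * b ^ 3 * (ℓ + δ)) - b ^ 6 * (C ^ 2 * ℓ ^ 2 + h * b ^ 3 * ℓ)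
      = δ * (b ^ 6 * (2 * C ^ 2 * ℓ + h * b ^ 3)) + C ^ 2 * b ^ 6 * δ ^ 2 := by
  ring

/-- the exit pair at a root: `f = s² + λ₀ b¹² = (s + μb⁶)(s - μb⁶)` when `μ² = -λ₀`. -/
theorem exit_pair (s μ lam0 b : K) (hμ : μ ^ 2 = -lam0) :
    s ^ 2 + lam0 * b ^ 12 = (s + μ * b ^ 6) * (s - μ * b ^ 6) := by
  have : lam0 = -μ ^ 2 := by rw [hμ]; ring
  subst this
  ring

end Traces

end Summit.ResolutionOfSingularities.ResolutionOfSingularities.Cruxes.EquisingularLiftNatThree.ToricTowers.R25
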